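import Literature.NumberTheory.ComplexMultiplication.CasselmanHeckeCharacterCMStructure
import Literature.AlgebraicGeometry.ComplexMultiplication.CMTypeOfRealisation
import Literature.NumberTheory.ComplexMultiplication.ReflexTypeOnInducedReflexType
import Literature.NumberTheory.Automorphic.Liu2021.Def45CMTypeIff
import Literature.NumberTheory.Automorphic.Liu2021.Def45CMCharacter
import Literature.AlgebraicGeometry.Motives.AbelianVarietyTateModuleFaithful
import HarnessLib

/-!
# [Liu 2021] Proposition 4.6 (1), first clause «`𝒜(μ)` is nonempty», from Casselman's theorem

Y. Liu, *Fourier–Jacobi cycles and arithmetic relative trace formula*, Camb. J. Math. **9** (2021) = arXiv:2102.11518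
[Liu2021], `FJcycle.tex` (md5 `6db49a74122d…`): Prop. 4.6 (1) l. 1969 «The category `𝒜(μ)` is a nonempty and connected
partially ordered set», proof ll. 1975–1984: «By Casselman's theorem [Shi71, Theorem 6] … there is a CM abelian variety
`A'` over [a finite extension] … we obtain an element `(A_μ, i_μ) …`. The existence of `λ_μ` and `r_μ` is obvious.»
[Shi71, Thm. 6] = G. Shimura, Ann. of Math. 94 (1971), Thm. 6 = [Shimura1998] §21.4 Thm. 21.4 («due to W. Casselman»),
recorded in the tree as the named fact `ComplexMultiplication.shimura1998_thm21_4_casselman`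
(`CasselmanHeckeCharacterCMStructure.lean`).

THIS FILE (theorems only; no definition, no named fact) derives an inhabitant of item6-p1's as-printed object type
`Liu2021.Def45.CMDatum` — the END-display binder `hObj` of the cells' S2 lane at the one-object rest (`X3-CARRIERS`
§5.1: `Obj := PLift (Nonempty (Def45.CMDatum …))`) — from Casselman's theorem in the ONE-STEP VARIANT of Liu's proof:
apply [Shimura1998] Thm. 21.4 directly at the INDUCED type `(K, Φ) := (M_μ, Ψ̃_μ)` (`Ψ̃_μ` = the CM type of `M_μ`
induced from the reflex type `Ψ_μ` of `(E, Φ_μ)`, `Def45AsPrinted`/`ReflexNormInducedType`), over `k := E` itself, for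
`χ := μ^{alg}` and the lattice `𝔞 := 𝔬_{M_μ}`; no auxiliary field `E'` and no Weil restriction are needed, because
Thm. 21.4 (unlike [Shi71] Thm. 6 as used at l. 1977) allows a non-primitive type and any `k ⊇ K*`.

* §1 `of_injective` — `End(A) → End⁰(A) = ℚ ⊗ End(A)` is injective (`End(A)` is a free `ℤ`-module, Mumford §19
  Thm. 3 = tree `module_free_hom_holds`), and the bookkeeping `M⁻¹·(1 ⊗ f) = 1 ⊗ g ⟹ f = M·g ⟹ T_ℓ f = M·T_ℓ g`.
* §2 `isCMCharacterMuAlgHecke_of_frobenius` — the SECOND BULLET of Def. 4.5 (2) in item6-p1's Hecke form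
  (`Def45.IsCMCharacterMuAlgHecke`) from the «determines `χ`» clauses of Casselman's theorem (the family `(χ_τ)` with
  `χ_{τ₀} = μ^{alg}` and the Frobenius element `π_v ∈ 𝔬_{M_μ}` acting on `T_ℓ`), for every RATIONAL presentation
  `i(π_v) = M⁻¹·(1 ⊗ f)`.
* §3 **`nonempty_cmDatum_of_casselman`** — `Nonempty (Def45.CMDatum (AlgHom.id ℚ F) σ hμ hw (Carriers.ofPolDR μ P))`
  for a CM field `F` Galois over `ℚ` (the cells' `E = F`), a pin `σ : F → ℂ`, `μ` conjugate symplectic of weight one,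
  GIVEN: Casselman's theorem `h21`; of the (19.10a, b) clauses for `χ = μ^{alg}` at `(M_μ, Ψ̃_μ, k = F)`, FOUR are PROVED
  here — «`k ⊇ K*`» (`traceField_inducedCMType_reflexCMType_subset_range`: `K** ⊂ K`), (19.10a) (the ∞-type of `μ^{alg}`,
  `hasInfinityType_muAlg_of_weight_one`, IS `cmInfinityType Ψ̃_μ τ₀ σ` by the duality
  `reflexTypeOn_inducedCMType_reflexCMType`), «`χ(x) ∈ K^×`» (`M_μ` is by definition generated by the finite-idele values of
  `μ^{alg}`) and «`χ(x)χ(x)^ρ = |x|⁻¹`» (`|μ^{alg}(x)|² = ‖x‖⁻¹`) — while the ideal clause «`χ(x)𝔞 = f(x)𝔞`» at local units /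
  uniformisers stays as the DISPLAYED hypotheses `hu`, `hπ` on `μ` (properties of the character `μ` alone, not of any posited
  carrier: unit values on local units, and the Shimura–Taniyama factorisation `(μ^{alg}(ϖ_v)) = g(N 𝔭_v)`; not in this file);
  and an inhabitant of the posited ⟨CARRIER⟩ `P` of the last two bullets `(λ_μ, r_μ)` («obvious», l. 1984 — no dual
  abelian variety / de Rham homology over `E` in the tree).
  The REAL fields are produced: `A := A₀`, `i` extending `ι₀` (`exists_ringHom_endAlgebra`), `finrank_eq`
  (`IsCMTypeRealisationOver.finrank_eq`), `det45` — Liu's FIRST BULLET — by `Def45CMTypeIff.det45_of_inducedCMType_eq_cmType`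
  over `cmType_eq_of_isCMTypeRealisation` (the CM type of `A₀ ⊗_{F,σ} ℂ` read on `H^{1,0}` IS `Ψ̃_μ`), and `isCMCharacter` by §2.

HONEST SCOPE.  Conditional on the CITED `h21` and on the displayed `μ`-hypotheses; nothing about Liu's `X_K`, `A_K`,
`Ω(μ)` or HC_CM.  No statement of [Liu2021] is weakened: the produced datum satisfies Def. 4.5 (2) AS TYPED.

## References
* [Liu2021] Y. Liu, Camb. J. Math. 9 (2021) = arXiv:2102.11518 — Def. 4.5 (ll. 1936–1964), Prop. 4.6 (1) (l. 1969) and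
  its proof (ll. 1975–1984).
* [Shimura1998] G. Shimura, *Abelian Varieties with Complex Multiplication and Modular Functions* (1998), §21.4
  Thm. 21.4, Prop. 19.10, Thm. 19.11.
* [Shimura1971ZetaCM] G. Shimura, Ann. of Math. 94 (1971), Thm. 6.
* [MumfordAV1970] D. Mumford, *Abelian Varieties* (1970), §19 Thm. 3 (`End(A)` free of finite rank).
-/

set_option autoImplicit false

noncomputable section

open scoped TensorProduct NumberField ComplexConjugate
open CategoryTheory IsDedekindDomain NumberField
open Literature.AlgebraicGeometry.Motives Literature.AlgebraicGeometry.HodgeTheory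
open Literature.AlgebraicGeometry.ComplexMultiplication
open Literature.NumberTheory.ComplexMultiplication
open Literature.NumberTheory.GaloisRepresentations

namespace Literature.NumberTheory.Automorphic.Liu2021.Def45

/-! ## §1 `End(A) ↪ End⁰(A)` and presentations `M⁻¹ · (1 ⊗ f)` -/

section OfInjective

universe u

variable {k : Type u} [Field k] (A : AbelianVariety k)

/-- **`End(A) → End⁰(A) = ℚ ⊗_ℤ End(A)`, `f ↦ 1 ⊗ f`, is injective**: `End(A)` is a free `ℤ`-module (Mumford §19
Thm. 3; tree `AbelianVariety.module_free_hom_holds`), hence flat, and `ℤ → ℚ` is injective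
(`Module.Flat.rTensor_preserves_injective_linearMap`). [cite: MumfordAV1970, §19 Thm. 3] -/
theorem of_injective : Function.Injective (AbelianVariety.endAlgebra.of A) := by
  haveI : Module.Free ℤ (A ⟶ A) := AbelianVariety.module_free_hom_holds A A
  have hinj : Function.Injective ((Algebra.linearMap ℤ ℚ).rTensor (A ⟶ A)) :=
    Module.Flat.rTensor_preserves_injective_linearMap _ (RingHom.injective_int (algebraMap ℤ ℚ))
  intro f g h
  have h1 : (Algebra.linearMap ℤ ℚ).rTensor (A ⟶ A) ((1 : ℤ) ⊗ₜ[ℤ] (f : A ⟶ A)) =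
      (Algebra.linearMap ℤ ℚ).rTensor (A ⟶ A) ((1 : ℤ) ⊗ₜ[ℤ] (g : A ⟶ A)) := by
    rw [LinearMap.rTensor_tmul, LinearMap.rTensor_tmul, Algebra.linearMap_apply, map_one]
    exact h
  have h2 := congrArg (TensorProduct.lid ℤ (A ⟶ A)) (hinj h1)
  rw [TensorProduct.lid_tmul, TensorProduct.lid_tmul, one_smul, one_smul] at h2
  exact h2

/-- If `M⁻¹ · (1 ⊗ f) = 1 ⊗ g` in `End⁰(A)` with `M ≠ 0`, then `f = M · g` in `End(A)`. [cite: MumfordAV1970, §19 Thm. 3] -/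
theorem eq_nsmul_of_algebraMap_inv_mul_of_eq_of {M : ℕ} (hM : M ≠ 0) {f g : CategoryTheory.End A}
    (h : algebraMap ℚ A.endAlgebra (M : ℚ)⁻¹ * AbelianVariety.endAlgebra.of A f = AbelianVariety.endAlgebra.of A g) :
    f = M • g := by
  have hM' : (M : ℚ) ≠ 0 := Nat.cast_ne_zero.2 hM
  have h3 : algebraMap ℚ A.endAlgebra (M : ℚ) * (algebraMap ℚ A.endAlgebra (M : ℚ)⁻¹ * AbelianVariety.endAlgebra.of A f) =
      algebraMap ℚ A.endAlgebra (M : ℚ) * AbelianVariety.endAlgebra.of A g := by rw [h]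
  rw [← mul_assoc, ← map_mul, mul_inv_cancel₀ hM', map_one, one_mul, map_natCast] at h3
  refine of_injective A (h3.trans ?_)
  rw [map_nsmul, nsmul_eq_mul]

end OfInjective

/-! ## §2 The second bullet of Def. 4.5 (2) from the «determines `χ`» clauses -/

section SecondBullet

variable {E : Type} [Field E] [NumberField E] {μ : IdeleClassGroup E →ₜ* Circle}

omit [NumberField E] in
/-- `T_ℓ (n • f) = n • T_ℓ f` (additivity of `T_ℓ`; Mumford §19). [cite: MumfordAV1970, §19] -/
private theorem tateModuleMap_nsmul' {A : AbelianVariety E} (ℓ : ℕ) [Fact ℓ.Prime] (n : ℕ) (f : A ⟶ A) :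
    AbelianVariety.tateModuleMap ℓ (n • f) = n • AbelianVariety.tateModuleMap ℓ f := by
  induction n with
  | zero => rw [zero_smul, zero_smul, AbelianVariety.tateModuleMap_zero]
  | succ n ih => rw [succ_nsmul, succ_nsmul, AbelianVariety.tateModuleMap_add, ih]

/-- **[Liu2021, Def. 4.5 (2)] SECOND BULLET (Hecke form `IsCMCharacterMuAlgHecke`) from the clauses of Casselman's
theorem.**  If `(A, ι₀ : 𝓞_{M_μ} → End_E A)` comes with a family `(χ_τ)_{τ : M_μ → ℂ}` of Hecke characters of `E` whose
member at the inclusion `M_μ ⊆ ℂ` is `μ^{alg}`, and at every good place `v` a Frobenius element `π_v ∈ 𝓞_{M_μ}` with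
`χ_τ(ϖ_v) = τ(π_v)` acting on `T_ℓ A` (`v ∤ ℓ`) as every arithmetic Frobenius, then the RATIONAL extension
`i : M_μ → End⁰(A)` of `ι₀` satisfies the second bullet: for every presentation `i(π_v) = M⁻¹·(1 ⊗ f)`,
`M · ρ_ℓ(σ) = T_ℓ(f)` (`f = M · ι₀(π_v)` in `End A`, `End(A) ↪ End⁰(A)`). [cite: Liu2021, Def. 4.5 (2) (TeX l. 1952)]
[cite: Shimura1998, Thm. 19.11 (proof) and §21.4 Thm. 21.4] -/
theorem isCMCharacterMuAlgHecke_of_frobenius {A : AbelianVariety E}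
    (ι₀ : 𝓞 (IdeleClassGroup.muAlgValueField E μ) →+* CategoryTheory.End A)
    (i : IdeleClassGroup.muAlgValueField E μ →+* A.endAlgebra)
    (hi : ∀ a, i (algebraMap _ (IdeleClassGroup.muAlgValueField E μ) a) = AbelianVariety.endAlgebra.of A (ι₀ a))
    (χ : (IdeleClassGroup.muAlgValueField E μ →+* ℂ) → HeckeCharacter E)
    (hχ : χ (IdeleClassGroup.muAlgValueField E μ).subtype = IdeleClassGroup.muAlg E μ)
    (hfrob : ∀ v : HeightOneSpectrum (𝓞 E),
      (∃ (𝒜 : SchemeOver (HeightOneSpectrum.valuationSubringAtPrime E v)) (_ : GrpObj 𝒜),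
        Literature.NumberTheory.DiophantineGeometry.IsAbelianSchemeModel A v 𝒜) →
      ∃ π : 𝓞 (IdeleClassGroup.muAlgValueField E μ),
        (∀ τ : IdeleClassGroup.muAlgValueField E μ →+* ℂ,
          (χ τ).valueAtUniformizer v = τ (π : IdeleClassGroup.muAlgValueField E μ)) ∧
        (∀ (ℓ : ℕ) [Fact ℓ.Prime], (ℓ : 𝓞 E) ∉ v.asIdeal →
          ∀ 𝔓 ∈ v.primesAbove, ∀ σ : Field.absoluteGaloisGroup E, IsArithFrobAt (𝓞 E) σ 𝔓 →
            A.tateRep ℓ σ = AbelianVariety.tateModuleMap ℓ (ι₀ π : A ⟶ A))) :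
    IsCMCharacterMuAlgHecke μ A i := by
  refine ⟨χ, fun v hv => ?_, hχ⟩
  obtain ⟨π, hπτ, hπ⟩ := hfrob v hv
  refine ⟨(π : IdeleClassGroup.muAlgValueField E μ), hπτ, fun M f hM hpres ℓ _ hℓ 𝔓 h𝔓 σ hσ => ?_⟩
  have hpres' : algebraMap ℚ A.endAlgebra (M : ℚ)⁻¹ * AbelianVariety.endAlgebra.of A f =
      AbelianVariety.endAlgebra.of A (ι₀ π) := by
    rw [← hpres, ← hi π]
  have hf : (f : CategoryTheory.End A) = M • ι₀ π := eq_nsmul_of_algebraMap_inv_mul_of_eq_of A hM hpres'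
  have hT : AbelianVariety.tateModuleMap ℓ f = M • AbelianVariety.tateModuleMap ℓ (ι₀ π : A ⟶ A) := by
    have h1 := congrArg (AbelianVariety.tateModuleMap (A := A) (B := A) ℓ) hf
    have h2 : AbelianVariety.tateModuleMap ℓ ((M • ι₀ π : CategoryTheory.End A) : A ⟶ A) =
        M • AbelianVariety.tateModuleMap ℓ (ι₀ π : A ⟶ A) := tateModuleMap_nsmul' (A := A) ℓ M (ι₀ π : A ⟶ A)
    exact h1.trans h2
  rw [hT, ← hπ ℓ hℓ 𝔓 h𝔓 σ hσ, Nat.cast_smul_eq_nsmul]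

end SecondBullet

/-! ## §3 An object of `𝒜(μ)` from Casselman's theorem -/

section Main

variable {F : Type} [Field F] [NumberField F] [IsCMField F] [IsGalois ℚ F] (σ : F →+* ℂ)
  {μ : IdeleClassGroup F →ₜ* Circle} (hμ : IdeleClassGroup.IsConjugateSymplectic F μ)
  (hw : IdeleClassGroup.HasWeight F μ 1)

omit [IsCMField F] [IsGalois ℚ F] in
/-- **«`χ(x) ∈ K^×` for `x ∈ k_h^×`» for `χ = μ^{alg}`, `K = M_μ`**: by DEFINITION `M_μ ⊆ ℂ` is generated by the values of
`μ^{alg}` on the finite ideles ([Liu2021] l. 1928; tree `coe_muAlg_mem_muAlgValueField`). [cite: Liu2021, §4.1 (TeX l. 1928)]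
[cite: Shimura1998, Prop. 19.10 (19.10b)] -/
theorem exists_coe_muAlg_eq (x : ideleGroup F) (hx : (x : AdeleRing (𝓞 F) F).1 = 1) :
    ∃ b : IdeleClassGroup.muAlgValueField F μ,
      ((IdeleClassGroup.muAlg F μ x : ℂˣ) : ℂ) = (IdeleClassGroup.muAlgValueField F μ).subtype b :=
  ⟨⟨_, IdeleClassGroup.coe_muAlg_mem_muAlgValueField F μ hx⟩, rfl⟩

omit [IsCMField F] [IsGalois ℚ F] in
/-- **«`χ(x)χ(x)^ρ = |x|_A⁻¹`» for `χ = μ^{alg}`** (read in `ℂ`): `μ^{alg}(x)·\overline{μ^{alg}(x)} = |μ^{alg}(x)|² = ‖x‖⁻¹`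
since `μ` is unitary and `μ^{alg} = μ·‖·‖^{-1/2}` (tree `norm_muAlg_apply`). [cite: Liu2021, §4.1 (TeX l. 1922)]
[cite: Shimura1998, Prop. 19.10 (19.10b)] -/
theorem coe_muAlg_mul_conj (x : ideleGroup F) :
    ((IdeleClassGroup.muAlg F μ x : ℂˣ) : ℂ) * conj ((IdeleClassGroup.muAlg F μ x : ℂˣ) : ℂ) =
      (((ideleNorm x)⁻¹ : ℝ) : ℂ) := by
  have h0 : 0 ≤ ideleNorm x := by
    unfold ideleNorm
    exact mul_nonneg (Finset.prod_nonneg fun w _ => pow_nonneg (norm_nonneg _) _) (finprod_nonneg fun v => norm_nonneg _)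
  rw [Complex.mul_conj, Complex.normSq_eq_norm_sq, IdeleClassGroup.norm_muAlg_apply, inv_pow, Real.sq_sqrt h0,
    Complex.ofReal_inv]

include hw in
/-- **(19.10a) for `χ = μ^{alg}` at the induced type**: the ∞-type of `μ^{alg}` — `z ↦ z⁻¹` through the embeddings of
`Φ_μ` (weight one; tree `hasInfinityType_muAlg_of_weight_one`) — IS the reflex ∞-type `cmInfinityType Ψ̃_μ τ₀ σ` of
[Shimura1998] (19.10a) for `(K, Φ) = (M_μ, Ψ̃_μ)`, `k = F`, by the duality `reflexTypeOn Ψ̃_μ τ₀ σ = Φ_μ`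
(`cmInfinityType_inducedCMType_reflexCMType`). [cite: Shimura1998, Prop. 19.10 (19.10a)]
[cite: Liu2021, Def. 4.3 and the display after it (TeX ll. 1915–1926)] -/
theorem hasInfinityType_muAlg_cmInfinityType :
    (IdeleClassGroup.muAlg F μ).HasInfinityType
      (cmInfinityType (inducedCMType (incl (AlgHom.id ℚ F) σ hμ) (reflexCMType σ hμ.cmType (AlgHom.id ℚ F))).1
        (IdeleClassGroup.muAlgValueField F μ).subtype σ).1
      (cmInfinityType (inducedCMType (incl (AlgHom.id ℚ F) σ hμ) (reflexCMType σ hμ.cmType (AlgHom.id ℚ F))).1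
        (IdeleClassGroup.muAlgValueField F μ).subtype σ).2 := by
  have hσ : σ.comp ((AlgHom.id ℚ F : F →ₐ[ℚ] F) : F →+* F) = σ := RingHom.ext fun _ => rfl
  have hcm := cmInfinityType_inducedCMType_reflexCMType hμ.cmType (AlgHom.id ℚ F) σ (incl (AlgHom.id ℚ F) σ hμ)
    (IdeleClassGroup.muAlgValueField F μ).subtype (coe_incl (AlgHom.id ℚ F) σ hμ)
  rw [hσ] at hcm
  rw [hcm]
  -- the ∞-type `e` of `μ` takes the values `±1` (weight one)
  obtain ⟨e', he', hwe'⟩ := hw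
  have hee : hμ.infinityType = e' := hμ.infinityType_eq he'
  have h1 : ∀ w, hμ.infinityType w = 1 ∨ hμ.infinityType w = -1 := fun w => by
    have hw1 : (hμ.infinityType w).natAbs = 1 := by
      have := congrFun hwe' w
      rw [IdeleClassGroup.weight_apply, Pi.one_apply] at this
      rw [hee]; exact this
    omega
  have hμ' := IdeleClassGroup.hasInfinityType_muAlg_of_weight_one hμ.hasInfinityType_infinityType h1
  have hp : (HeckeCharacter.typeOfExponent (hμ.cmType.1.indicator fun _ => (1 : ℤ))).1 =
      fun w => if hμ.infinityType w = -1 then 1 else 0 := by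
    funext w
    change (hμ.cmType.1.indicator fun _ => (1 : ℤ)) w.embedding = _
    have hmem : w.embedding ∈ hμ.cmType.1 ↔ hμ.infinityType w = -1 := by
      change w.embedding ∈ (IdeleClassGroup.cmTypeOf F hμ.infinityType hμ.infinityType_ne_zero).1 ↔ _
      rw [IdeleClassGroup.mem_cmTypeOf_iff, IdeleClassGroup.exponentAt_embedding]
      rcases h1 w with h | h <;> rw [h] <;> decide
    by_cases hw' : hμ.infinityType w = -1
    · rw [Set.indicator_of_mem (hmem.2 hw'), if_pos hw']
    · rw [Set.indicator_of_notMem (fun h => hw' (hmem.1 h)), if_neg hw']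
  have hq : (HeckeCharacter.typeOfExponent (hμ.cmType.1.indicator fun _ => (1 : ℤ))).2 =
      fun w => if hμ.infinityType w = -1 then 0 else 1 := by
    classical
    funext w
    have hwc : w.IsComplex := NumberField.IsTotallyComplex.isComplex w
    change (if w.IsReal then 0 else (hμ.cmType.1.indicator fun _ => (1 : ℤ)) (ComplexEmbedding.conjugate w.embedding)) = _
    rw [if_neg (NumberField.InfinitePlace.not_isReal_iff_isComplex.2 hwc)]
    have hmem : ComplexEmbedding.conjugate w.embedding ∈ hμ.cmType.1 ↔ ¬ hμ.infinityType w = -1 := by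
      change ComplexEmbedding.conjugate w.embedding ∈
          (IdeleClassGroup.cmTypeOf F hμ.infinityType hμ.infinityType_ne_zero).1 ↔ _
      rw [IdeleClassGroup.mem_cmTypeOf_iff, IdeleClassGroup.exponentAt_conjugate_embedding _ hwc]
      rcases h1 w with h | h <;> rw [h] <;> decide
    by_cases hw' : hμ.infinityType w = -1
    · rw [Set.indicator_of_notMem (fun h => (hmem.1 h) hw'), if_pos hw']
    · rw [Set.indicator_of_mem (hmem.2 hw'), if_neg hw']
  rw [hp, hq]
  exact hμ'

/-- **[Liu2021, Prop. 4.6 (1)], first clause «`𝒜(μ)` is nonempty», from Casselman's theorem (one-step variant).**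
For a CM field `F` Galois over `ℚ`, a pin `σ : F → ℂ`, `μ` conjugate symplectic of weight one with value field
`M_μ ⊆ ℂ`, CM type `Φ_μ` and induced type `Ψ̃_μ = inducedCMType incl (reflexCMType σ Φ_μ id)` on `M_μ`: GIVEN
Casselman's theorem `h21` ([Shimura1998] Thm. 21.4, the tree's named fact), the displayed hypotheses on `μ` `hu`/`hπ`
((19.10b) ideal clause «`χ(x)𝔞 = f(x)𝔞`» at local units / uniformisers) and an inhabitant `hP` of the posited pair
`(λ_μ, r_μ)`, THERE IS a CM datum `D_μ = (A_μ, i_μ, λ_μ, r_μ)` in the as-printed sense of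
`Def45.CMDatum` over `Carriers.ofPolDR μ P`: `A_μ := A₀` and `i_μ` the rational extension of `ι₀` for the structure
`(A₀, ι₀)` of type `(M_μ, Ψ̃_μ)` over `F` determining `μ^{alg}`; `[M_μ:ℚ] = 2 dim A_μ`; the FIRST BULLET
(`det(i_μ(x) | Lie) = η_μ(x)`, `Def45CMTypeIff.det45_of_inducedCMType_eq_cmType` over `cmType_eq_of_isCMTypeRealisation`);
the SECOND BULLET (`isCMCharacterMuAlgHecke_of_frobenius`).  «`k ⊇ K*`», (19.10a), «`χ(x) ∈ K^×`», «`χχ^ρ = |x|⁻¹`»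
are proved (`traceField_inducedCMType_reflexCMType_subset_range`, `hasInfinityType_muAlg_cmInfinityType`,
`exists_coe_muAlg_eq`, `coe_muAlg_mul_conj`). [cite: Liu2021, Prop. 4.6 (1) (TeX l. 1969) and its proof (ll. 1975–1984)]
[cite: Shimura1998, §21.4 Thm. 21.4] [cite: Shimura1971ZetaCM, Theorem 6] -/
theorem nonempty_cmDatum_of_casselman (h21 : shimura1998_thm21_4_casselman)
    (hu : haveI := hμ.numberField_muAlgValueField
      ∀ (v : HeightOneSpectrum (𝓞 F)) (u : (v.adicCompletionIntegers F)ˣ),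
        ∃ b : (𝓞 (IdeleClassGroup.muAlgValueField F μ))ˣ,
          (((IdeleClassGroup.muAlg F μ).localComponent v
              (Units.map ((v.adicCompletionIntegers F).subtype : _ →* _) u) : ℂˣ) : ℂ) =
            (IdeleClassGroup.muAlgValueField F μ).subtype
              ((b : 𝓞 (IdeleClassGroup.muAlgValueField F μ)) : IdeleClassGroup.muAlgValueField F μ))
    (hπ : haveI := hμ.numberField_muAlgValueField
      ∀ v : HeightOneSpectrum (𝓞 F), ∃ π : 𝓞 (IdeleClassGroup.muAlgValueField F μ),
        (IdeleClassGroup.muAlg F μ).valueAtUniformizer v =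
            (IdeleClassGroup.muAlgValueField F μ).subtype (π : IdeleClassGroup.muAlgValueField F μ) ∧
          ∀ (L : Type) [Field L] [NumberField L] [Normal ℚ L] (ιL : L →+* ℂ)
            (j : IdeleClassGroup.muAlgValueField F μ →+* L) (σL : F →+* L), ιL.comp σL = σ →
            IsReflexTypeNorm
              (valuedIn ιL (inducedCMType (incl (AlgHom.id ℚ F) σ hμ) (reflexCMType σ hμ.cmType (AlgHom.id ℚ F))).1)
              j σL v.asIdeal (Ideal.span {π}))
    (P : ∀ A : AbelianVariety F, (IdeleClassGroup.muAlgValueField F μ →+* A.endAlgebra) → Type)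
    (hP : ∀ A i, Nonempty (P A i)) :
    Nonempty (CMDatum (AlgHom.id ℚ F) σ hμ hw (Carriers.ofPolDR μ P)) := by
  haveI := hμ.numberField_muAlgValueField
  haveI := hμ.isCMField_muAlgValueField
  letI : Algebra F ℂ := σ.toAlgebra
  have hσ : algebraMap F ℂ = σ := RingHom.algebraMap_toAlgebra σ
  -- Casselman's theorem at `(K, Φ) = (M_μ, Ψ̃_μ)`, `k = F`, `τ₀ = (M_μ ⊆ ℂ)`, `χ = μ^alg`
  obtain ⟨A₀, ι₀, hA, χfam, hχ, hfrob⟩ :=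
    shimura1998_thm21_4_casselman.exists_structure (k := F) (K := IdeleClassGroup.muAlgValueField F μ)
      (Φ := inducedCMType (incl (AlgHom.id ℚ F) σ hμ) (reflexCMType σ hμ.cmType (AlgHom.id ℚ F)))
      (τ₀ := (IdeleClassGroup.muAlgValueField F μ).subtype) (χ := IdeleClassGroup.muAlg F μ) h21
      (by
        rw [hσ]
        have hK := traceField_inducedCMType_reflexCMType_subset_range hμ.cmType (AlgHom.id ℚ F) σ
          (incl (AlgHom.id ℚ F) σ hμ)
        have hσ' : σ.comp ((AlgHom.id ℚ F : F →ₐ[ℚ] F) : F →+* F) = σ := RingHom.ext fun _ => rfl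
        rw [hσ'] at hK
        exact hK)
      (by rw [hσ]; exact hasInfinityType_muAlg_cmInfinityType σ hμ hw)
      (fun x hx => ⟨exists_coe_muAlg_eq (μ := μ) x hx, coe_muAlg_mul_conj (μ := μ) x⟩) hu
      (fun v => by
        obtain ⟨π, hπv, hπL⟩ := hπ v
        exact ⟨π, hπv, fun L _ _ _ ιL j σL hc => hπL L ιL j σL (by rw [← hσ]; exact hc)⟩)
  -- the rational extension `i : M_μ → End⁰(A₀)` of `ι₀`
  obtain ⟨i, hi⟩ := exists_ringHom_endAlgebra (A₀ := A₀) ι₀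
  have hdim : Module.finrank ℚ (IdeleClassGroup.muAlgValueField F μ) = 2 * A₀.dim := hA.finrank_eq
  -- the CM type of `A₀ ⊗_{F,σ} ℂ` read on `H^{1,0}` through `i ⊗ ℂ` is `Ψ̃_μ`
  obtain ⟨θ, hθ⟩ := hA
  have hφι : ∀ a : 𝓞 (IdeleClassGroup.muAlgValueField F μ),
      ((AbelianVariety.endAlgebraBaseChange ℂ A₀).toRingHom.comp i) (a : IdeleClassGroup.muAlgValueField F μ) =
        AbelianVariety.endAlgebra.of (A₀.baseChange ℂ) (((A₀.endBaseChange ℂ).comp ι₀) a) := fun a => by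
    rw [RingHom.comp_apply, RingHom.comp_apply, AbelianVariety.endBaseChange_apply]
    change AbelianVariety.endAlgebraBaseChange ℂ A₀ (i (algebraMap _ _ a)) = _
    rw [hi a, AbelianVariety.endAlgebraBaseChange_of]
  have hdimℂ : Module.finrank ℚ (IdeleClassGroup.muAlgValueField F μ) = 2 * (A₀.baseChange ℂ).dim := by
    rw [AbelianVariety.dim_baseChange]; exact hdim
  have hΨ := (cmType_eq_of_isCMTypeRealisation_holds
    ((AbelianVariety.endAlgebraBaseChange ℂ A₀).toRingHom.comp i) hdimℂ hφι hθ).symm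
  refine ⟨{ A := A₀
            i := i
            finrank_eq := hdim
            det45 := fun x M f hM h =>
              det45_of_inducedCMType_eq_cmType σ hμ A₀ i hdim (incl (AlgHom.id ℚ F) σ hμ)
                (coe_incl (AlgHom.id ℚ F) σ hμ) hΨ x M f hM h
            isCMCharacter := ?_
            polDR := (hP A₀ i).some }⟩
  -- the second bullet
  rw [Carriers.ofPolDR_isCMCharacter]
  exact isCMCharacterMuAlgHecke_of_frobenius ι₀ i hi χfam hχ hfrob

end Main

end Literature.NumberTheory.Automorphic.Liu2021.Def45

end
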